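import Summits.MatrixMultiplication.MatrixMultiplication.Theses.IsotypicSaturation
import Literature.Computability.AlgebraicComplexity.UnitTensorMomentPolytopeHolds

set_option linter.dupNamespace false
set_option autoImplicit false

/-!
# IsotypicSaturation — the crux `UnitTensorPolytopeMaximal` (stmt 4418) HOLDS, by name

`route-MatrixMultiplication-IsotypicSaturation`, crux #3 `UnitTensorPolytopeMaximal` (rank 3, item
stmt-MatrixMultiplication-4418): "the moment polytope of the unit tensor `⟨4⟩` is maximal among tensors with all three
dimensions `≤ 4`", in semigroup-saturation form.  Its statement is VERBATIM the Literature named fact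
`vandenBergEtAl2025_unitTensor_four_polytope_maximal`, which the tree has since DISCHARGED
(`vandenBergEtAl2025_unitTensor_four_polytope_maximal_holds`, module `UnitTensorMomentPolytopeHolds`: the `4×4×4` Kronecker
polytope by its 14+ facet families and vertex occurrence, computer-certified in Lean).  This file closes the item by that theorem.
(Filed by the decomp-mm lens-3 seat, which uses the same fact for the SAT half of `P_O` at `n = 2`,
`Theorems/ObstructionDescentSaturationSplit.lean`.)  Sorry-free; standard axioms.
[cite: vandenBergChristandlLysikovNieuwboerWalterZuiddam2025, §1 after Cor. 1.5] [cite: BurgisserIkenmeyer2011, Problem 8.3]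
-/

namespace Summit.MatrixMultiplication.MatrixMultiplication.Theorems

open Literature.Computability.AlgebraicComplexity (vandenBergEtAl2025_unitTensor_four_polytope_maximal_holds)

/-- **`UnitTensorPolytopeMaximal` holds**: every triple occurring in a positive tensor power of a tensor of format `≤ 4×4×4` has a
positive multiple occurring in the corresponding power of `⟨4⟩` (van den Berg–Christandl–Lysikov–Nieuwboer–Walter–Zuiddam 2025,
"Kron(4,4,4) = Δ(⟨4⟩)"; tree theorem `vandenBergEtAl2025_unitTensor_four_polytope_maximal_holds`).
[cite: vandenBergChristandlLysikovNieuwboerWalterZuiddam2025, §1 after Cor. 1.5] -/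
theorem unitTensorPolytopeMaximal_holds :
    Summit.MatrixMultiplication.MatrixMultiplication.Theses.IsotypicSaturation.UnitTensorPolytopeMaximal :=
  fun hι hκ hμ s n lam hn h => vandenBergEtAl2025_unitTensor_four_polytope_maximal_holds hι hκ hμ s n lam hn h

end Summit.MatrixMultiplication.MatrixMultiplication.Theorems
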